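import Literature.Barriers.QuantumFields.UnitaryHaarSmallBall
import Mathlib.Analysis.CStarAlgebra.ContinuousFunctionalCalculus.Unitary
import HarnessLib

/-!
# Haar measure of small operator-norm balls in `U(N)`: the upper bound, and tubes

Companion to `UnitaryHaarSmallBall.lean` (the lower bound
`μ {‖V − 1‖_op ≤ ρ} ≥ (ρ/(2π + ρ))^{N²}`). Here, for every left-invariant probability measure `μ`
on `U(N)` and every `ρ > 0`,

  `μ {V ∈ U(N) : ‖V − 1‖_op ≤ ρ} ≤ (3ρ)^{N²}`                    (`haar_unitaryOpBall_le`),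

so that the small-ball probability is `ρ^{N²} e^{O(N²)}` with `N`-UNIFORM constants on both sides
(the metric entropy of the unitary group, two-sided), and the resulting TUBE BOUND
(`measure_thickening_le`): the closed `ρ`-neighbourhood of a set `S ⊆ U(N)` admitting a `ρ`-net
`Q` has measure `≤ #Q · (6ρ)^{N²}` — the tool by which `N`-uniform small-ball UPPER bounds for
structured subsets (subgroups, near-block-diagonal or near-commuting configurations) are reduced
to covering-number counts, as needed for the open estimate `EKSymSmallBallBound` isolated in
`EguchiKawaiBreakdownLowerBound.lean`.

## The argument (packing/covering duality, no Weyl integration formula)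

* PACKING: if the points of a finite `P ⊆ U(N)` are pairwise more than `2ρ` apart, the left
  translates of the `ρ`-ball are disjoint, so `#P · μ(ball) ≤ 1`
  (`card_mul_measure_unitaryOpBall_le_one`); by the LOWER bound such `P` are uniformly finite, so
  a maximal one exists and is a `2ρ`-net (`exists_separated_net`).
* COVERING from below: the Hermitian part `U ↦ (U + U⋆)/2` is `1`-Lipschitz (`norm_hermPart_sub_le`)
  and maps `U(N)` ONTO the Hermitian contractions — every Hermitian `H` with `‖H‖ ≤ 1` is the
  Hermitian part of the unitary `H + i√(1 − H²)`, built with the continuous functional calculus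
  (`exists_unitary_hermPart_eq`); hence a `2ρ`-net of `U(N)` yields, in the real coordinates
  `uCoords` of `UnitaryHaarSmallBall.lean`, a cover of the unit `uOpNorm`-ball by `3ρ`-balls, which
  by Lebesgue volume scaling needs `≥ (3ρ)^{−N²}` of them (`one_le_card_mul_pow_of_cover`,
  `one_le_card_net_mul_pow`).
* Together: `μ(ball_ρ) ≤ 1/#P ≤ (3ρ)^{N²}`.

## References

* Folklore; the sharp two-sided entropy estimate is S. Szarek, *Metric entropy of homogeneous
  spaces*, Banach Center Publ. 43 (1998). Everything here is proved from Mathlib.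
-/

open Complex NormedSpace MeasureTheory
open scoped Real Matrix.Norms.L2Operator Pointwise ENNReal NNReal

noncomputable section

namespace Literature.Barriers.QuantumFields

variable {N : ℕ}

/-- The Hermitian part `(A + A⋆)/2` of a square matrix. This is (the coercion of) Mathlib's
bundled `selfAdjointPart ℝ A : selfAdjoint (Matrix (Fin N) (Fin N) ℂ)`
(`Mathlib/Algebra/Star/Module.lean`), kept here as an unbundled matrix-valued `def` for
readability of the norm estimates below; the identification is `hermPart_eq_selfAdjointPart`.
[folklore] -/
def hermPart (A : Matrix (Fin N) (Fin N) ℂ) : Matrix (Fin N) (Fin N) ℂ := (2 : ℂ)⁻¹ • (A + star A)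

/-- `hermPart A` is Mathlib's `selfAdjointPart ℝ A` (as a matrix). [folklore] -/
theorem hermPart_eq_selfAdjointPart (A : Matrix (Fin N) (Fin N) ℂ) :
    hermPart A = ((selfAdjointPart ℝ A : selfAdjoint (Matrix (Fin N) (Fin N) ℂ)) :
      Matrix (Fin N) (Fin N) ℂ) := by
  rw [selfAdjointPart_apply_coe, invOf_eq_inv, hermPart]
  ext i j
  simp [mul_add]

/-- The Hermitian part is self-adjoint (it is `selfAdjointPart ℝ A`). [folklore] -/
theorem hermPart_isSelfAdjoint (A : Matrix (Fin N) (Fin N) ℂ) : IsSelfAdjoint (hermPart A) := by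
  rw [hermPart_eq_selfAdjointPart]
  exact (selfAdjointPart ℝ A).prop

/-- The Hermitian part is Hermitian. [folklore] -/
theorem hermPart_isHermitian (A : Matrix (Fin N) (Fin N) ℂ) : Matrix.IsHermitian (hermPart A) :=
  Matrix.isHermitian_iff_isSelfAdjoint.2 (hermPart_isSelfAdjoint A)

/-- The Hermitian part is `1`-Lipschitz in operator norm: `‖(A + A⋆)/2 − (B + B⋆)/2‖ ≤ ‖A − B‖`. [folklore] -/
theorem norm_hermPart_sub_le (A B : Matrix (Fin N) (Fin N) ℂ) :
    ‖hermPart A - hermPart B‖ ≤ ‖A - B‖ := by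
  have h : hermPart A - hermPart B = (2 : ℂ)⁻¹ • ((A - B) + star (A - B)) := by
    unfold hermPart; rw [star_sub, ← smul_sub]; congr 1; abel
  rw [h, norm_smul]
  have h2 : ‖(2 : ℂ)⁻¹‖ = 2⁻¹ := by simp
  rw [h2]
  have := norm_add_le (A - B) (star (A - B))
  rw [norm_star] at this
  linarith

/-- **Every Hermitian contraction is the Hermitian part of a unitary**: for self-adjoint `H` with
`‖H‖_op ≤ 1`, `U = H + i√(1 − H²)` (continuous functional calculus with `f(x) = x + i√(1 − x²)`,
`|f| = 1` on `σ(H) ⊆ [−1, 1]`) is unitary with `(U + U⋆)/2 = H`. [folklore] -/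
theorem exists_unitary_hermPart_eq {H : Matrix (Fin N) (Fin N) ℂ} (hH : IsSelfAdjoint H)
    (hH1 : ‖H‖ ≤ 1) : ∃ U : Matrix.unitaryGroup (Fin N) ℂ, hermPart (U : Matrix (Fin N) (Fin N) ℂ) = H := by
  rcases Nat.eq_zero_or_pos N with hN | hN
  · subst hN
    refine ⟨1, ?_⟩
    ext i j
    exact Fin.elim0 i
  haveI : Nonempty (Fin N) := ⟨⟨0, hN⟩⟩
  letI : CStarAlgebra (Matrix (Fin N) (Fin N) ℂ) := {}
  haveI : IsStarNormal H := hH.isStarNormal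
  set f : ℂ → ℂ := fun z => ((z.re : ℝ) : ℂ) + I * ((Real.sqrt (1 - z.re ^ 2) : ℝ) : ℂ) with hf
  have hfc : Continuous f := by rw [hf]; fun_prop
  have hfc' : Continuous fun z => star (f z) := hfc.star
  have hspec : ∀ z ∈ spectrum ℂ H, z = (z.re : ℂ) ∧ z.re ^ 2 ≤ 1 := by
    intro z hz
    refine ⟨hH.mem_spectrum_eq_re hz, ?_⟩
    have h1 : ‖z‖ ≤ 1 := (spectrum.norm_le_norm_of_mem hz).trans hH1
    have h2 : |z.re| ≤ 1 := (Complex.abs_re_le_norm z).trans h1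
    have h3 : z.re ^ 2 = |z.re| ^ 2 := (sq_abs _).symm
    rw [h3]
    nlinarith [abs_nonneg z.re]
  have hU : cfc f H ∈ unitary (Matrix (Fin N) (Fin N) ℂ) := by
    rw [cfc_unitary_iff f H (hf := hfc.continuousOn)]
    intro z hz
    obtain ⟨-, hz2⟩ := hspec z hz
    have hs : Real.sqrt (1 - z.re ^ 2) ^ 2 = 1 - z.re ^ 2 := Real.sq_sqrt (by linarith)
    simp only [hf, star_add, star_mul, RCLike.star_def, Complex.conj_ofReal, Complex.conj_I]
    apply Complex.ext
    · simp only [Complex.add_re, Complex.mul_re, Complex.ofReal_re, Complex.ofReal_im,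
        Complex.I_re, Complex.I_im, Complex.neg_re, Complex.neg_im, Complex.one_re,
        Complex.add_im, Complex.mul_im]
      nlinarith [hs]
    · simp only [Complex.add_im, Complex.mul_im, Complex.ofReal_re, Complex.ofReal_im,
        Complex.I_re, Complex.I_im, Complex.neg_re, Complex.neg_im, Complex.one_im,
        Complex.add_re, Complex.mul_re]
      ring
  refine ⟨⟨cfc f H, hU⟩, ?_⟩
  show hermPart (cfc f H) = H
  unfold hermPart
  rw [← cfc_star f H, ← cfc_add (a := H) (f := f) (g := fun z => star (f z)) (hf := hfc.continuousOn)
      (hg := hfc'.continuousOn),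
    ← cfc_smul (2 : ℂ)⁻¹ (fun z => f z + star (f z)) H (hf := (hfc.add hfc').continuousOn)]
  conv_rhs => rw [← cfc_id' ℂ H]
  refine cfc_congr fun z hz => ?_
  obtain ⟨hz1, -⟩ := hspec z hz
  simp only [hf, star_add, star_mul, RCLike.star_def, Complex.conj_ofReal, Complex.conj_I, smul_eq_mul]
  rw [hz1]
  simp only [Complex.ofReal_re]
  ring


/-- `‖(A + A⋆)/2‖ ≤ ‖A‖`. [folklore] -/
theorem norm_hermPart_le (A : Matrix (Fin N) (Fin N) ℂ) : ‖hermPart A‖ ≤ ‖A‖ := by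
  have h := norm_hermPart_sub_le A 0
  have h0 : hermPart (0 : Matrix (Fin N) (Fin N) ℂ) = 0 := by simp [hermPart]
  rwa [h0, sub_zero, sub_zero] at h

/-! ### Volumetric LOWER bound on covering numbers in the coordinate space -/

/-- **Covering the unit ball needs `(1/ρ)^{N²}` balls**: if the open unit `uOpNorm`-ball of
`ℝ^{N²}` is covered by the `ρ`-balls around the points of `F`, then `1 ≤ #F · ρ^{N²}` (Lebesgue
volume scaling). [folklore] -/
theorem one_le_card_mul_pow_of_cover {ρ : ℝ} (hρ : 0 < ρ) (F : Finset (Fin N × Fin N → ℝ))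
    (hcov : uOpBall N 1 ⊆ ⋃ y ∈ F, (fun z => z + (-y)) ⁻¹' uOpBall N ρ) :
    (1 : ℝ) ≤ F.card * ρ ^ (N * N) := by
  have hvol1 : volume (uOpBall N ρ) = ENNReal.ofReal (ρ ^ (N * N)) * volume (uOpBall N 1) := by
    rw [← mul_one ρ, ← smul_uOpBall hρ, mul_one, Measure.addHaar_smul_of_nonneg volume hρ.le,
      finrank_uCoordSpace]
  have h1 : volume (uOpBall N 1) ≤ ∑ y ∈ F, volume ((fun z => z + (-y)) ⁻¹' uOpBall N ρ) :=
    (measure_mono hcov).trans (measure_biUnion_finset_le F _)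
  simp only [measure_preimage_add_right, Finset.sum_const, nsmul_eq_mul] at h1
  rw [hvol1, ← mul_assoc] at h1
  have hV0 : volume (uOpBall N 1) ≠ 0 := (volume_uOpBall_pos one_pos).ne'
  have hVt : volume (uOpBall N 1) ≠ ⊤ := (volume_uOpBall_lt_top 1).ne
  have h2 : 1 * volume (uOpBall N 1) ≤ ((F.card : ℝ≥0∞) * ENNReal.ofReal (ρ ^ (N * N))) *
      volume (uOpBall N 1) := by rwa [one_mul]
  have h3 : (1 : ℝ≥0∞) ≤ (F.card : ℝ≥0∞) * ENNReal.ofReal (ρ ^ (N * N)) :=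
    (ENNReal.mul_le_mul_iff_left hV0 hVt).1 h2
  have h4 : ENNReal.ofReal 1 ≤ ENNReal.ofReal ((F.card : ℝ) * ρ ^ (N * N)) := by
    rw [ENNReal.ofReal_one, ENNReal.ofReal_mul (Nat.cast_nonneg _), ENNReal.ofReal_natCast]
    exact h3
  exact (ENNReal.ofReal_le_ofReal_iff (by positivity)).1 h4

/-! ### Separated subsets of `U(N)` and the upper bound -/

/-- Left translates of the ball: `g⁻¹V ∈ ball_ρ ↔ ‖V − g‖_op ≤ ρ` (left multiplication by a
unitary is an isometry of the operator norm). [folklore] -/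
theorem mem_preimage_unitaryOpBall_iff {g V : Matrix.unitaryGroup (Fin N) ℂ} {ρ : ℝ} :
    V ∈ (fun W => g⁻¹ * W) ⁻¹' unitaryOpBall N ρ ↔
      ‖(V : Matrix (Fin N) (Fin N) ℂ) - (g : Matrix (Fin N) (Fin N) ℂ)‖ ≤ ρ := by
  rw [Set.mem_preimage, mem_unitaryOpBall]
  have key : ‖((g⁻¹ * V : Matrix.unitaryGroup (Fin N) ℂ) : Matrix (Fin N) (Fin N) ℂ) - 1‖ =
      ‖(V : Matrix (Fin N) (Fin N) ℂ) - (g : Matrix (Fin N) (Fin N) ℂ)‖ := by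
    obtain h0 | h0 := subsingleton_or_nontrivial (Matrix (Fin N) (Fin N) ℂ)
    · exact congrArg _ (Subsingleton.elim _ _)
    have hgg : (g : Matrix (Fin N) (Fin N) ℂ) * star (g : Matrix (Fin N) (Fin N) ℂ) = 1 :=
      Unitary.coe_mul_star_self g
    have hsg : star (g : Matrix (Fin N) (Fin N) ℂ) * (g : Matrix (Fin N) (Fin N) ℂ) = 1 :=
      Unitary.coe_star_mul_self g
    have hfac : (V : Matrix (Fin N) (Fin N) ℂ) - (g : Matrix (Fin N) (Fin N) ℂ) =
        (g : Matrix (Fin N) (Fin N) ℂ) * (((g⁻¹ * V : Matrix.unitaryGroup (Fin N) ℂ) :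
          Matrix (Fin N) (Fin N) ℂ) - 1) := by
      show _ = (g : Matrix (Fin N) (Fin N) ℂ) * (star (g : Matrix (Fin N) (Fin N) ℂ) * (V : Matrix (Fin N) (Fin N) ℂ) - 1)
      rw [mul_sub, ← mul_assoc, hgg, one_mul, mul_one]
    have hfac' : (((g⁻¹ * V : Matrix.unitaryGroup (Fin N) ℂ) : Matrix (Fin N) (Fin N) ℂ) - 1) =
        star (g : Matrix (Fin N) (Fin N) ℂ) * ((V : Matrix (Fin N) (Fin N) ℂ) - (g : Matrix (Fin N) (Fin N) ℂ)) := by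
      show star (g : Matrix (Fin N) (Fin N) ℂ) * (V : Matrix (Fin N) (Fin N) ℂ) - 1 = _
      rw [mul_sub, hsg]
    apply le_antisymm
    · rw [hfac']
      calc _ ≤ ‖star (g : Matrix (Fin N) (Fin N) ℂ)‖ * ‖(V : Matrix (Fin N) (Fin N) ℂ) - (g : Matrix (Fin N) (Fin N) ℂ)‖ :=
            norm_mul_le _ _
        _ = _ := by rw [CStarRing.norm_of_mem_unitary (Unitary.star_mem g.2), one_mul]
    · conv_lhs => rw [hfac]
      calc _ ≤ ‖(g : Matrix (Fin N) (Fin N) ℂ)‖ * ‖((g⁻¹ * V : Matrix.unitaryGroup (Fin N) ℂ) :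
            Matrix (Fin N) (Fin N) ℂ) - 1‖ := norm_mul_le _ _
        _ = _ := by rw [CStarRing.norm_coe_unitary g, one_mul]
  rw [key]

/-- **Packing**: if the points of `P ⊆ U(N)` are pairwise more than `2ρ` apart in operator norm,
then `#P · μ(ball_ρ) ≤ 1` for every left-invariant probability measure `μ` (the translates
`g · ball_ρ`, `g ∈ P`, are disjoint). [folklore] -/
theorem card_mul_measure_unitaryOpBall_le_one (μ : Measure (Matrix.unitaryGroup (Fin N) ℂ))
    [IsProbabilityMeasure μ] [μ.IsMulLeftInvariant] {ρ : ℝ}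
    (P : Finset (Matrix.unitaryGroup (Fin N) ℂ))
    (hsep : ∀ g ∈ P, ∀ g' ∈ P, g ≠ g' →
      2 * ρ < ‖(g : Matrix (Fin N) (Fin N) ℂ) - (g' : Matrix (Fin N) (Fin N) ℂ)‖) :
    (P.card : ℝ≥0∞) * μ (unitaryOpBall N ρ) ≤ 1 := by
  set B : Matrix.unitaryGroup (Fin N) ℂ → Set (Matrix.unitaryGroup (Fin N) ℂ) :=
    fun g => (fun W => g⁻¹ * W) ⁻¹' unitaryOpBall N ρ with hB
  have hBmeas : ∀ g, MeasurableSet (B g) := fun g =>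
    (measurableSet_unitaryOpBall ρ).preimage (measurable_const_mul _)
  have hdisj : (P : Set (Matrix.unitaryGroup (Fin N) ℂ)).PairwiseDisjoint B := by
    intro g hg g' hg' hne
    rw [Function.onFun, Set.disjoint_left]
    intro V hV hV'
    rw [hB, mem_preimage_unitaryOpBall_iff] at hV hV'
    have h1 : ‖(g : Matrix (Fin N) (Fin N) ℂ) - (g' : Matrix (Fin N) (Fin N) ℂ)‖ ≤ 2 * ρ := by
      calc _ = ‖((g : Matrix (Fin N) (Fin N) ℂ) - V) + ((V : Matrix (Fin N) (Fin N) ℂ) - g')‖ := by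
            rw [sub_add_sub_cancel]
        _ ≤ ‖(g : Matrix (Fin N) (Fin N) ℂ) - V‖ + ‖(V : Matrix (Fin N) (Fin N) ℂ) - g'‖ := norm_add_le _ _
        _ ≤ ρ + ρ := add_le_add (by rwa [norm_sub_rev]) hV'
        _ = 2 * ρ := by ring
    exact absurd (hsep g hg g' hg' hne) (not_lt.2 h1)
  calc (P.card : ℝ≥0∞) * μ (unitaryOpBall N ρ) = ∑ g ∈ P, μ (B g) := by
        simp [hB, measure_preimage_mul]
    _ = μ (⋃ g ∈ P, B g) := (measure_biUnion_finset hdisj (fun g _ => hBmeas g)).symm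
    _ ≤ μ Set.univ := measure_mono (Set.subset_univ _)
    _ = 1 := measure_univ

/-- **Maximal separated sets are nets**: for `ρ > 0` there is a finite `P ⊆ U(N)`, pairwise more
than `2ρ` apart, within `2ρ` of every unitary. (Separated sets are uniformly finite by the packing
bound and the LOWER small-ball bound `haar_unitaryOpBall_ge` for the Haar probability measure, so
a separated set of maximal cardinality exists; maximality is the net property.) [folklore] -/
theorem exists_separated_net {ρ : ℝ} (hρ : 0 < ρ) :
    ∃ P : Finset (Matrix.unitaryGroup (Fin N) ℂ),
      (∀ g ∈ P, ∀ g' ∈ P, g ≠ g' →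
        2 * ρ < ‖(g : Matrix (Fin N) (Fin N) ℂ) - (g' : Matrix (Fin N) (Fin N) ℂ)‖) ∧
      ∀ U : Matrix.unitaryGroup (Fin N) ℂ, ∃ g ∈ P,
        ‖(U : Matrix (Fin N) (Fin N) ℂ) - (g : Matrix (Fin N) (Fin N) ℂ)‖ ≤ 2 * ρ := by
  classical
  set μ : Measure (Matrix.unitaryGroup (Fin N) ℂ) :=
    Literature.MathematicalPhysics.QuantumFieldTheory.haarProbability (Matrix.unitaryGroup (Fin N) ℂ) with hμ
  haveI : μ.IsMulLeftInvariant := by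
    rw [hμ]; dsimp [Literature.MathematicalPhysics.QuantumFieldTheory.haarProbability]; infer_instance
  let good : Finset (Matrix.unitaryGroup (Fin N) ℂ) → Prop := fun P =>
    ∀ g ∈ P, ∀ g' ∈ P, g ≠ g' → 2 * ρ < ‖(g : Matrix (Fin N) (Fin N) ℂ) - (g' : Matrix (Fin N) (Fin N) ℂ)‖
  let Pk : ℕ → Prop := fun k => ∃ P, good P ∧ P.card = k
  -- cardinality cap from the lower small-ball bound
  set q : ℝ := (ρ / (2 * π + ρ)) ^ (N * N) with hq
  have hqpos : 0 < q := by positivity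
  set Bd : ℕ := ⌊1 / q⌋₊ with hBd
  have hcard : ∀ P, good P → P.card ≤ Bd := by
    intro P hP
    have h1 := card_mul_measure_unitaryOpBall_le_one μ P hP
    have h2 : ENNReal.ofReal q ≤ μ (unitaryOpBall N ρ) := haar_unitaryOpBall_ge μ hρ
    have h3 : (P.card : ℝ≥0∞) * ENNReal.ofReal q ≤ 1 := le_trans (by gcongr) h1
    have h4 : (P.card : ℝ) * q ≤ 1 := by
      have : ENNReal.ofReal ((P.card : ℝ) * q) ≤ ENNReal.ofReal 1 := by
        rw [ENNReal.ofReal_mul (Nat.cast_nonneg _), ENNReal.ofReal_natCast, ENNReal.ofReal_one]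
        exact h3
      exact (ENNReal.ofReal_le_ofReal_iff zero_le_one).1 this
    refine Nat.le_floor ?_
    rw [le_div_iff₀ hqpos]
    exact h4
  have hP0 : Pk 0 := ⟨∅, by simp [good], rfl⟩
  set k₀ := Nat.findGreatest Pk Bd with hk₀
  obtain ⟨P₀, hgood, hcardP₀⟩ : Pk k₀ := Nat.findGreatest_spec (Nat.zero_le Bd) hP0
  refine ⟨P₀, hgood, fun U => ?_⟩
  by_contra hcon
  push Not at hcon
  have hU : U ∉ P₀ := by
    intro hU
    have := hcon U hU
    rw [sub_self, norm_zero] at this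
    linarith
  have hgood' : good (insert U P₀) := by
    intro a ha b hb hab
    rw [Finset.mem_insert] at ha hb
    rcases ha with ha | ha
    · rcases hb with hb | hb
      · exact absurd (ha.trans hb.symm) hab
      · rw [ha]; exact hcon b hb
    · rcases hb with hb | hb
      · rw [hb, norm_sub_rev]; exact hcon a ha
      · exact hgood a ha b hb hab
  have hP1 : Pk (k₀ + 1) := ⟨insert U P₀, hgood', by rw [Finset.card_insert_of_notMem hU, hcardP₀]⟩
  have hle : k₀ + 1 ≤ Bd := by
    have := hcard _ hgood'
    rwa [Finset.card_insert_of_notMem hU, hcardP₀] at this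
  exact Nat.findGreatest_is_greatest (Nat.lt_succ_self k₀) hle hP1

/-- **A `2ρ`-net of `U(N)` has at least `(3ρ)^{−N²}` points**: the Hermitian parts of the net
points are within `2ρ` of every Hermitian contraction (`exists_unitary_hermPart_eq`,
`norm_hermPart_sub_le`), so in coordinates the `3ρ`-balls around them cover the unit
`uOpNorm`-ball. [folklore] -/
theorem one_le_card_net_mul_pow (P : Finset (Matrix.unitaryGroup (Fin N) ℂ)) {ρ : ℝ} (hρ : 0 < ρ)
    (hnet : ∀ U : Matrix.unitaryGroup (Fin N) ℂ, ∃ g ∈ P,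
      ‖(U : Matrix (Fin N) (Fin N) ℂ) - (g : Matrix (Fin N) (Fin N) ℂ)‖ ≤ 2 * ρ) :
    (1 : ℝ) ≤ P.card * (3 * ρ) ^ (N * N) := by
  classical
  set c : Matrix.unitaryGroup (Fin N) ℂ → (Fin N × Fin N → ℝ) :=
    fun g => uCoords (hermPart (g : Matrix (Fin N) (Fin N) ℂ)) with hc
  set F := P.image c with hF
  have hcov : uOpBall N 1 ⊆ ⋃ y ∈ F, (fun z => z + (-y)) ⁻¹' uOpBall N (3 * ρ) := by
    intro x hx
    have hx1 : ‖uHerm x‖ < 1 := hx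
    obtain ⟨U, hU⟩ := exists_unitary_hermPart_eq (uHerm_isSelfAdjoint x) hx1.le
    obtain ⟨g, hg, hUg⟩ := hnet U
    refine Set.mem_iUnion₂.2 ⟨c g, Finset.mem_image_of_mem c hg, ?_⟩
    show uOpNorm (x + -c g) < 3 * ρ
    rw [← sub_eq_add_neg, uOpNorm, uHerm_sub, hc]
    simp only []
    rw [uHerm_uCoords (hermPart_isHermitian _), ← hU]
    calc ‖hermPart (U : Matrix (Fin N) (Fin N) ℂ) - hermPart (g : Matrix (Fin N) (Fin N) ℂ)‖
        ≤ ‖(U : Matrix (Fin N) (Fin N) ℂ) - (g : Matrix (Fin N) (Fin N) ℂ)‖ := norm_hermPart_sub_le _ _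
      _ ≤ 2 * ρ := hUg
      _ < 3 * ρ := by linarith
  have h1 := one_le_card_mul_pow_of_cover (by positivity) F hcov
  have hcardF : (F.card : ℝ) ≤ P.card := by exact_mod_cast Finset.card_image_le
  have : (0 : ℝ) ≤ (3 * ρ) ^ (N * N) := by positivity
  nlinarith

/-- **Haar measure of small balls in `U(N)`, UPPER bound uniform in `N`:**
`μ {V : ‖V − 1‖_op ≤ ρ} ≤ (3ρ)^{N²}` for every left-invariant probability measure `μ` on `U(N)`
and every `ρ > 0`. With `haar_unitaryOpBall_ge` (`≥ (ρ/(2π + ρ))^{N²}`): `μ(ball_ρ) = ρ^{N²} e^{O(N²)}`,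
the two-sided metric entropy of the unitary group. [folklore] -/
theorem haar_unitaryOpBall_le (μ : Measure (Matrix.unitaryGroup (Fin N) ℂ)) [IsProbabilityMeasure μ]
    [μ.IsMulLeftInvariant] {ρ : ℝ} (hρ : 0 < ρ) :
    μ (unitaryOpBall N ρ) ≤ ENNReal.ofReal ((3 * ρ) ^ (N * N)) := by
  obtain ⟨P, hsep, hnet⟩ := exists_separated_net (N := N) hρ
  have h1 := card_mul_measure_unitaryOpBall_le_one μ P hsep
  have h2 := one_le_card_net_mul_pow P hρ hnet
  have hcard_pos : (0 : ℝ) < P.card := by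
    rcases Nat.eq_zero_or_pos P.card with h0 | h0
    · rw [h0, Nat.cast_zero, zero_mul] at h2; linarith
    · exact_mod_cast h0
  -- μ(B) ≤ 1 / #P ≤ (3ρ)^{N²}
  have h3 : μ (unitaryOpBall N ρ) ≤ (P.card : ℝ≥0∞)⁻¹ :=
    ENNReal.le_inv_iff_mul_le.2 (by rwa [mul_comm] at h1)
  refine h3.trans ?_
  rw [← ENNReal.ofReal_natCast, ← ENNReal.ofReal_inv_of_pos hcard_pos]
  apply ENNReal.ofReal_le_ofReal
  rw [inv_le_iff_one_le_mul₀ hcard_pos]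
  linarith [h2]

/-- **Tube bound**: if every point of `S ⊆ U(N)` is within `ρ` (operator norm) of the finite set
`Q`, then the closed `ρ`-neighbourhood of `S` has measure `≤ #Q · (6ρ)^{N²}` for every
left-invariant probability measure: `N`-uniform small-ball upper bounds for structured subsets of
`U(N)` reduce to covering-number counts. [folklore] -/
theorem measure_thickening_le (μ : Measure (Matrix.unitaryGroup (Fin N) ℂ)) [IsProbabilityMeasure μ]
    [μ.IsMulLeftInvariant] {ρ : ℝ} (hρ : 0 < ρ) (S : Set (Matrix.unitaryGroup (Fin N) ℂ))
    (Q : Finset (Matrix.unitaryGroup (Fin N) ℂ))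
    (hQ : ∀ s ∈ S, ∃ q ∈ Q, ‖(s : Matrix (Fin N) (Fin N) ℂ) - (q : Matrix (Fin N) (Fin N) ℂ)‖ ≤ ρ) :
    μ {U | ∃ s ∈ S, ‖(U : Matrix (Fin N) (Fin N) ℂ) - (s : Matrix (Fin N) (Fin N) ℂ)‖ ≤ ρ} ≤
      (Q.card : ℝ≥0∞) * ENNReal.ofReal ((6 * ρ) ^ (N * N)) := by
  have hcov : {U : Matrix.unitaryGroup (Fin N) ℂ | ∃ s ∈ S,
      ‖(U : Matrix (Fin N) (Fin N) ℂ) - (s : Matrix (Fin N) (Fin N) ℂ)‖ ≤ ρ} ⊆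
      ⋃ q ∈ Q, (fun W => q⁻¹ * W) ⁻¹' unitaryOpBall N (2 * ρ) := by
    rintro U ⟨s, hs, hUs⟩
    obtain ⟨q, hq, hsq⟩ := hQ s hs
    refine Set.mem_iUnion₂.2 ⟨q, hq, ?_⟩
    rw [mem_preimage_unitaryOpBall_iff]
    calc ‖(U : Matrix (Fin N) (Fin N) ℂ) - (q : Matrix (Fin N) (Fin N) ℂ)‖
        = ‖((U : Matrix (Fin N) (Fin N) ℂ) - s) + ((s : Matrix (Fin N) (Fin N) ℂ) - q)‖ := by
          rw [sub_add_sub_cancel]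
      _ ≤ ρ + ρ := (norm_add_le _ _).trans (add_le_add hUs hsq)
      _ = 2 * ρ := by ring
  calc μ _ ≤ ∑ q ∈ Q, μ ((fun W => q⁻¹ * W) ⁻¹' unitaryOpBall N (2 * ρ)) :=
        (measure_mono hcov).trans (measure_biUnion_finset_le Q _)
    _ = (Q.card : ℝ≥0∞) * μ (unitaryOpBall N (2 * ρ)) := by
        simp [measure_preimage_mul]
    _ ≤ (Q.card : ℝ≥0∞) * ENNReal.ofReal ((6 * ρ) ^ (N * N)) := by
        gcongr
        have := haar_unitaryOpBall_le μ (by positivity : 0 < 2 * ρ)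
        rwa [show 3 * (2 * ρ) = 6 * ρ by ring] at this

end Literature.Barriers.QuantumFields
end
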